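import Literature.MathematicalPhysics.QuantumLattice.HubbardPairDensityCouplingFloorSharp
import Literature.MathematicalPhysics.QuantumLattice.FreeFermiGasPairingCostUniform
import Literature.MathematicalPhysics.QuantumLattice.PairCorrelationsProofs
import Literature.MathematicalPhysics.QuantumLattice.LatticeToriLROProofs
import HarnessLib

/-!
# Ground-state `d`-wave pair density of the repulsive Hubbard torus is `O(U log²(1/U))` — at every filling

Family `hubbard` / topic `MathematicalPhysics/QuantumLattice`; proof-only. Companion of
`HubbardPairDensityCouplingFloorOptimal.lean` (`c ≤ 1024 U^{2/3}`, every filling) and of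
`HubbardPairDensityCouplingCeiling.lean` / `HubbardDWaveLROCeiling.lean`
(`c ≤ (16384/δ)·U·log(4 + 32/√U)` at hole doping `δ ∈ (0,1/2)` and EVEN side, where the free Fermi
level avoids the van Hove level). With the filling-uniform pairing-cost rate `a/(10⁵ log²(4 + 32/√a))`
of `FreeFermiGasPairingCostUniform.lean` the same two-line energy balance (pairing cost versus the
first-order kinetic budget `U·L²` of a sector ground state) gives a ceiling with an ABSOLUTE constant,
valid at every filling, every side beyond the finite-size threshold, odd or even:

* `le_mul_log_sq_of_le_mul_log_sq_sqrt_self` (`'`) — elementary inversion of the implicit bound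
  `c ≤ A·U·log²(4 + 32/√c)` to `c ≤ A·U·log²(4 + 32/√(A·U)) ≤ A·U·log²(4 + 32/√U)`;
* `hubbardTorus_groundState_pairLRO_coupling_floor_uniform` — a normalised ground state `ψ` of
  `hubbardTorus 2 L 1 U` (`U ≥ 0`) in a sector `(2n, S^z = 0)`, `n ≤ L²`, `L ≥ ⌈3200/√c⌉ + 3`, with
  `Re ⟨ψ, Δ_d†Δ_d ψ⟩ ≥ c·L⁴` forces `c/(10⁵·log²(4 + 32/√c)) ≤ U`;
* `pairDensity_le_mul_coupling_mul_log_sq_coupling` — **closed form `c ≤ 10⁵·U·log²(4 + 32/√U)`**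
  (`U > 0`); `re_expect_pairField_dWave_lt_of_groundStateInSector_uniform`,
  `hubbardTorus_groundState_pairDensity_lt_of_log_sq_coupling_lt` — the a-priori forms (every `N`);
* `liminf_dWavePairFieldCorr_le_of_groundStates_uniform` — IN THE SUMMIT'S FORMAT and beyond it: for
  `U > 0`, ANY electron numbers `N : ℕ → ℕ` and any family `ψ` of normalised sector ground states at
  the even sides, `liminf_k |Λ_{2k}|⁻² Σ_{x,y} torusPullback (pairFieldCorr g_d ψ) (2k) x y ≤
  10⁵·U·log²(4 + 32/√U)`; `…_doping` — the literal hypothesis clause of `hubbard.S01` at ANY `δ`.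

Reading (regime map for every route to the summit, now uniform): whatever `(U, δ)` witnesses
`HubbardSuperconductivity` — or any variant at another filling, odd sides, or a ground-state selection —
the order-parameter density it exhibits is at most `10⁵·U·log²(4 + 32/√U) → 0` (`U → 0⁺`). The extra
logarithm against the doped ceiling is the van Hove density of states (pairing IS cheaper by a
logarithm at the van Hove filling); the constant no longer blows up as `δ → 0`. The expected truth is
`e^{-O(1/U²)}`-small (`Literature/Barriers/HubbardSuperconductivity/PerturbativeInvisibilityOfPairing.lean`);
closing that gap needs a second-order kinetic budget (correlation-energy bounds), not a better pairing
inequality.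

Sources: Bardeen–Cooper–Schrieffer, Phys. Rev. 108 (1957) 1175, §II–III; L. Van Hove, Phys. Rev. 89
(1953) 1189; D. J. Scalapino, Phys. Rep. 250 (1995) 329, §2 eq. (2.4); C. N. Yang, Rev. Mod. Phys.
34 (1962) 694, §3; H. Tasaki, Physics and Mathematics of Quantum Many-Body Systems (2020) §2.2;
Friedli–Velenik (2017) §3.7.2 Definition 3.27. Folklore finite-dimensional statements; no named
facts, no definitions. Tree search: `freeDWavePairing_costs_energy_uniform_rate`,
`re_expect_hubbardTorus_zero_le_of_groundStateInSector`, `le_sq_of_mem_szSector_two_mul_zero`,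
`le_mul_log_of_le_mul_log_sqrt_self` (the `log¹` inversion), `torusLROSeq_pairFieldCorr_succ`,
`posSemidef_conjTranspose_mul_self`, `Filter.liminf_le_of_frequently_le`.
-/

noncomputable section

namespace Literature.MathematicalPhysics.QuantumLattice

open Matrix Finset Filter Literature.Probability.LatticeModels
open scoped ComplexOrder ComplexConjugate

/-! ### Elementary inversion of the implicit `log²` bound -/

/-- `1 ≤ log(4 + 32/√x)` for every real `x` (`32/√x ≥ 0`, `log 4 ≥ 1`). [folklore] -/
theorem one_le_log_four_add_div_sqrt (x : ℝ) : 1 ≤ Real.log (4 + 32 / Real.sqrt x) := by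
  have hlog4 : (1 : ℝ) ≤ Real.log 4 := by
    rw [← Real.log_exp 1]
    refine Real.log_le_log (Real.exp_pos 1) ?_
    have := Real.exp_one_lt_d9
    linarith
  refine hlog4.trans (Real.log_le_log (by norm_num) ?_)
  have : 0 ≤ 32 / Real.sqrt x := div_nonneg (by norm_num) (Real.sqrt_nonneg _)
  linarith

/-- **Inversion.** If `0 < c ≤ A·U·log²(4 + 32/√c)` then `c ≤ A·U·log²(4 + 32/√(A·U))`: either
`c ≤ A·U` (and `log²(4 + ·) ≥ 1`), or `A·U < c` and the logarithm is antitone in `c` and `≥ 0`. (The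
hypothesis forces `A·U > 0`.) [folklore] -/
theorem le_mul_log_sq_of_le_mul_log_sq_sqrt_self {c A U : ℝ} (hc : 0 < c)
    (h : c ≤ A * U * Real.log (4 + 32 / Real.sqrt c) ^ 2) :
    c ≤ A * U * Real.log (4 + 32 / Real.sqrt (A * U)) ^ 2 := by
  have hlogc : 1 ≤ Real.log (4 + 32 / Real.sqrt c) := one_le_log_four_add_div_sqrt c
  have hAU : 0 < A * U := by
    by_contra hAU
    push Not at hAU
    have : A * U * Real.log (4 + 32 / Real.sqrt c) ^ 2 ≤ 0 :=
      mul_nonpos_of_nonpos_of_nonneg hAU (sq_nonneg _)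
    linarith
  have hlogAU : 1 ≤ Real.log (4 + 32 / Real.sqrt (A * U)) := one_le_log_four_add_div_sqrt (A * U)
  rcases le_or_gt c (A * U) with hle | hlt
  · have hsq : (1 : ℝ) ≤ Real.log (4 + 32 / Real.sqrt (A * U)) ^ 2 := by nlinarith
    calc c ≤ A * U := hle
      _ = A * U * 1 := (mul_one _).symm
      _ ≤ A * U * Real.log (4 + 32 / Real.sqrt (A * U)) ^ 2 := mul_le_mul_of_nonneg_left hsq hAU.le
  · have hsqrt : Real.sqrt (A * U) ≤ Real.sqrt c := Real.sqrt_le_sqrt hlt.le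
    have hpos : 0 < Real.sqrt (A * U) := Real.sqrt_pos.2 hAU
    have h32 : 32 / Real.sqrt c ≤ 32 / Real.sqrt (A * U) :=
      div_le_div_of_nonneg_left (by norm_num) hpos hsqrt
    have hlog : Real.log (4 + 32 / Real.sqrt c) ≤ Real.log (4 + 32 / Real.sqrt (A * U)) :=
      Real.log_le_log (by positivity) (by linarith)
    have hsq : Real.log (4 + 32 / Real.sqrt c) ^ 2 ≤ Real.log (4 + 32 / Real.sqrt (A * U)) ^ 2 :=
      pow_le_pow_left₀ (by linarith) hlog 2
    exact h.trans (mul_le_mul_of_nonneg_left hsq hAU.le)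

/-- **Inversion, cruder argument.** For `A ≥ 1`, `U > 0`: `0 < c ≤ A·U·log²(4 + 32/√c)` gives
`c ≤ A·U·log²(4 + 32/√U)` (`√U ≤ √(A·U)`). [folklore] -/
theorem le_mul_log_sq_of_le_mul_log_sq_sqrt_self' {c A U : ℝ} (hc : 0 < c) (hA : 1 ≤ A) (hU : 0 < U)
    (h : c ≤ A * U * Real.log (4 + 32 / Real.sqrt c) ^ 2) :
    c ≤ A * U * Real.log (4 + 32 / Real.sqrt U) ^ 2 := by
  have h1 := le_mul_log_sq_of_le_mul_log_sq_sqrt_self hc h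
  have hAU : 0 < A * U := by positivity
  have hsq : Real.sqrt U ≤ Real.sqrt (A * U) := Real.sqrt_le_sqrt (by nlinarith)
  have hposU : 0 < Real.sqrt U := Real.sqrt_pos.2 hU
  have h32 : 32 / Real.sqrt (A * U) ≤ 32 / Real.sqrt U :=
    div_le_div_of_nonneg_left (by norm_num) hposU hsq
  have hlog : Real.log (4 + 32 / Real.sqrt (A * U)) ≤ Real.log (4 + 32 / Real.sqrt U) :=
    Real.log_le_log (by positivity) (by linarith)
  have hlogAU : 1 ≤ Real.log (4 + 32 / Real.sqrt (A * U)) := one_le_log_four_add_div_sqrt (A * U)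
  have hsq2 : Real.log (4 + 32 / Real.sqrt (A * U)) ^ 2 ≤ Real.log (4 + 32 / Real.sqrt U) ^ 2 :=
    pow_le_pow_left₀ (by linarith) hlog 2
  exact h1.trans (mul_le_mul_of_nonneg_left hsq2 hAU.le)

/-- **The ceiling is positive**: `0 < A·U·log²(4 + 32/√U)` for `A, U > 0`. [folklore] -/
theorem mul_mul_log_sq_four_add_pos {A U : ℝ} (hA : 0 < A) (hU : 0 < U) :
    0 < A * U * Real.log (4 + 32 / Real.sqrt U) ^ 2 := by
  have : 0 < Real.log (4 + 32 / Real.sqrt U) := lt_of_lt_of_le one_pos (one_le_log_four_add_div_sqrt U)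
  positivity

/-! ### The coupling floor and its closed form, every filling -/

variable {L : ℕ} [NeZero L]

/-- **Coupling floor for `d`-wave pair LRO in a sector ground state — every filling, `log²` rate.**
If a normalised ground state `ψ` of `hubbardTorus 2 L 1 U` (`U ≥ 0`) in a sector `(2n, S^z = 0)`,
`n ≤ L²`, `L ≥ ⌈3200/√c⌉ + 3`, has `Re ⟨ψ, Δ_d†Δ_d ψ⟩ ≥ c·L⁴` (`c > 0`), then
`c/(10⁵·log²(4 + 32/√c)) ≤ U`: the interacting ground state has free kinetic energy at most `U·L²` above
the free sector ground energy (`re_expect_hubbardTorus_zero_le_of_groundStateInSector`), while the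
pair density `c` costs `c/(10⁵ log²(4 + 32/√c))·L²` (`freeDWavePairing_costs_energy_uniform_rate`).
Bardeen–Cooper–Schrieffer (1957) §II; Tasaki (2020) §2.2. [folklore] -/
theorem hubbardTorus_groundState_pairLRO_coupling_floor_uniform {c U : ℝ} (hc : 0 < c) (hU : 0 ≤ U)
    (hL : ⌈3200 / Real.sqrt c⌉₊ + 3 ≤ L) {n : ℕ} (hn : n ≤ L ^ 2)
    {ψ : Fock (Orb (FermionTorus 2 L))}
    (hψ : IsGroundStateInSector (hubbardTorus 2 L 1 U) (2 * n) 0 ψ) (h1 : star ψ ⬝ᵥ ψ = 1)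
    (hY : c * (L : ℝ) ^ 4 ≤
      (star ψ ⬝ᵥ (((pairField dWaveFormFactor L)ᴴ * pairField dWaveFormFactor L) *ᵥ ψ)).re) :
    c / (100000 * Real.log (4 + 32 / Real.sqrt c) ^ 2) ≤ U := by
  have hcost := freeDWavePairing_costs_energy_uniform_rate hc hL hψ.1 h1 hY
  have hfree := re_expect_hubbardTorus_zero_le_of_groundStateInSector hU hn hψ h1
  have hL2 : (0 : ℝ) < (L : ℝ) ^ 2 := by
    have : (0 : ℝ) < (L : ℝ) := by exact_mod_cast Nat.pos_of_ne_zero (NeZero.ne L)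
    positivity
  have hmul : c / (100000 * Real.log (4 + 32 / Real.sqrt c) ^ 2) * (L : ℝ) ^ 2 ≤ U * (L : ℝ) ^ 2 := by
    linarith
  exact le_of_mul_le_mul_right hmul hL2

/-- **Implicit form**: under the hypotheses of
`hubbardTorus_groundState_pairLRO_coupling_floor_uniform`, `c ≤ 10⁵·U·log²(4 + 32/√c)`. [folklore] -/
theorem pairDensity_le_mul_coupling_mul_log_sq {c U : ℝ} (hc : 0 < c) (hU : 0 ≤ U)
    (hL : ⌈3200 / Real.sqrt c⌉₊ + 3 ≤ L) {n : ℕ} (hn : n ≤ L ^ 2)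
    {ψ : Fock (Orb (FermionTorus 2 L))}
    (hψ : IsGroundStateInSector (hubbardTorus 2 L 1 U) (2 * n) 0 ψ) (h1 : star ψ ⬝ᵥ ψ = 1)
    (hY : c * (L : ℝ) ^ 4 ≤
      (star ψ ⬝ᵥ (((pairField dWaveFormFactor L)ᴴ * pairField dWaveFormFactor L) *ᵥ ψ)).re) :
    c ≤ 100000 * U * Real.log (4 + 32 / Real.sqrt c) ^ 2 := by
  have h := hubbardTorus_groundState_pairLRO_coupling_floor_uniform hc hU hL hn hψ h1 hY
  have hlog : 0 < Real.log (4 + 32 / Real.sqrt c) ^ 2 := by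
    have := one_le_log_four_add_div_sqrt c
    positivity
  rw [div_le_iff₀ (by positivity)] at h
  linarith

/-- **Closed form: the ground-state `d`-wave pair density at ANY filling is at most
`10⁵·U·log²(4 + 32/√U)`.** Under the hypotheses of
`hubbardTorus_groundState_pairLRO_coupling_floor_uniform` and `U > 0`: `c ≤ 10⁵·U·log²(4 + 32/√U)` —
the ground-state `d`-wave pair density of the weakly repulsive Hubbard torus is `O(U log²(1/U))` as
`U → 0⁺`, uniformly in the filling, the side (beyond the threshold `⌈3200/√c⌉ + 3`, any parity) and
the choice of ground state. Bardeen–Cooper–Schrieffer (1957) §II–III; Van Hove (1953). [folklore] -/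
theorem pairDensity_le_mul_coupling_mul_log_sq_coupling {c U : ℝ} (hc : 0 < c) (hU : 0 < U)
    (hL : ⌈3200 / Real.sqrt c⌉₊ + 3 ≤ L) {n : ℕ} (hn : n ≤ L ^ 2)
    {ψ : Fock (Orb (FermionTorus 2 L))}
    (hψ : IsGroundStateInSector (hubbardTorus 2 L 1 U) (2 * n) 0 ψ) (h1 : star ψ ⬝ᵥ ψ = 1)
    (hY : c * (L : ℝ) ^ 4 ≤
      (star ψ ⬝ᵥ (((pairField dWaveFormFactor L)ᴴ * pairField dWaveFormFactor L) *ᵥ ψ)).re) :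
    c ≤ 100000 * U * Real.log (4 + 32 / Real.sqrt U) ^ 2 :=
  le_mul_log_sq_of_le_mul_log_sq_sqrt_self' hc (by norm_num) hU
    (pairDensity_le_mul_coupling_mul_log_sq hc hU.le hL hn hψ h1 hY)

/-- **A-priori form, closed.** For `U > 0`, `c > 0` with `10⁵·U·log²(4 + 32/√U) < c`,
`L ≥ ⌈3200/√c⌉ + 3` and `n ≤ L²`, every normalised ground state of `hubbardTorus 2 L 1 U` in the sector
`(2n, S^z = 0)` has `Re ⟨ψ, Δ_d†Δ_d ψ⟩ < c·L⁴`. [folklore] -/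
theorem re_expect_pairField_dWave_lt_of_groundStateInSector_uniform {c U : ℝ} (hc : 0 < c)
    (hU : 0 < U) (hcU : 100000 * U * Real.log (4 + 32 / Real.sqrt U) ^ 2 < c)
    (hL : ⌈3200 / Real.sqrt c⌉₊ + 3 ≤ L) {n : ℕ} (hn : n ≤ L ^ 2)
    {ψ : Fock (Orb (FermionTorus 2 L))}
    (hψ : IsGroundStateInSector (hubbardTorus 2 L 1 U) (2 * n) 0 ψ) (h1 : star ψ ⬝ᵥ ψ = 1) :
    (star ψ ⬝ᵥ (((pairField dWaveFormFactor L)ᴴ * pairField dWaveFormFactor L) *ᵥ ψ)).re <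
      c * (L : ℝ) ^ 4 := by
  by_contra h
  push Not at h
  have := pairDensity_le_mul_coupling_mul_log_sq_coupling hc hU hL hn hψ h1 h
  linarith

/-- **Every-`N` form.** For `U > 0`, `c > 0` with `10⁵·U·log²(4 + 32/√U) < c`, all sides
`L ≥ ⌈3200/√c⌉ + 3`, every `N` and every normalised ground state `ψ` of `hubbardTorus 2 L 1 U` in the
sector `(N, S^z = 0)`: `Re ⟨ψ, Δ_d†Δ_d ψ⟩ < c·L⁴` (`N` is even or the sector is trivial; `N/2 ≤ L²`
automatically). In particular along any sequence of sector ground states, at any fillings,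
`limsup_L L⁻⁴ Re⟨ψ_L, Δ_d†Δ_d ψ_L⟩ ≤ 10⁵·U·log²(4 + 32/√U)`. [folklore] -/
theorem hubbardTorus_groundState_pairDensity_lt_of_log_sq_coupling_lt {c U : ℝ} (hc : 0 < c)
    (hU : 0 < U) (hcU : 100000 * U * Real.log (4 + 32 / Real.sqrt U) ^ 2 < c)
    (hL : ⌈3200 / Real.sqrt c⌉₊ + 3 ≤ L) {N : ℕ} {ψ : Fock (Orb (FermionTorus 2 L))}
    (hψ : IsGroundStateInSector (hubbardTorus 2 L 1 U) N 0 ψ) (h1 : star ψ ⬝ᵥ ψ = 1) :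
    (star ψ ⬝ᵥ (((pairField dWaveFormFactor L)ᴴ * pairField dWaveFormFactor L) *ᵥ ψ)).re <
      c * (L : ℝ) ^ 4 := by
  have h0 : ψ ≠ 0 := by rintro rfl; simp at h1
  obtain ⟨n, rfl⟩ := exists_eq_two_mul_of_mem_szSector_zero hψ.1 h0
  have hn := le_sq_of_mem_szSector_two_mul_zero hψ.1 h0
  exact re_expect_pairField_dWave_lt_of_groundStateInSector_uniform hc hU hcU hL hn hψ h1

/-! ### The summit's format: `liminf` of the even-side LRO sequence, any filling -/

omit [NeZero L] in
/-- **A-priori ceiling on the LRO amplitude in the format of `hubbard.S01`, uniform in the filling.**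
Let `U > 0` and let `N : ℕ → ℕ` (ANY electron numbers) and `ψ` be such that at every even side `L`,
`ψ L` is normalised and is a ground state of `hubbardTorus 2 L 1 U` in the sector `(N L, S^z = 0)`.
Then the sequence whose `liminf` the summit asks to be positive satisfies
`liminf_k |Λ_{2k}|⁻² Σ_{x,y ∈ Λ_{2k}} torusPullback (pairFieldCorr g_d ψ) (2k) x y ≤
10⁵·U·log²(4 + 32/√U)`, `Λ_{2k} = halfOpenBox 2 (2k)`: any witness `U` of the summit — at any doping,
indeed at any filling schedule — exhibits an order-parameter density `O(U log²(1/U))`. (The `k`-th term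
is `(2k)⁻⁴ Re ⟨ψ_{2k}, Δ_d†Δ_d ψ_{2k}⟩ ≥ 0` by `torusLROSeq_pairFieldCorr_succ`, and it is eventually
`< c` for every `c` above the ceiling by `hubbardTorus_groundState_pairDensity_lt_of_log_sq_coupling_lt`.)
Scalapino, Phys. Rep. 250 (1995) 329, §2 eq. (2.4); Friedli–Velenik (2017) §3.7.2. [folklore] -/
theorem liminf_dWavePairFieldCorr_le_of_groundStates_uniform {U : ℝ} (hU : 0 < U)
    (N : ℕ → ℕ) (ψ : ∀ L, Fock (Orb (FermionTorus 2 L)))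
    (hGS : ∀ L, Even L → star (ψ L) ⬝ᵥ ψ L = 1 ∧
      IsGroundStateInSector (hubbardTorus 2 L 1 U) (N L) 0 (ψ L)) :
    liminf (fun k : ℕ => (∑ x ∈ halfOpenBox 2 (2 * k), ∑ y ∈ halfOpenBox 2 (2 * k),
        torusPullback (pairFieldCorr dWaveFormFactor ψ) (2 * k) x y) /
          ((#(halfOpenBox 2 (2 * k)) : ℝ)) ^ 2) atTop ≤
      100000 * U * Real.log (4 + 32 / Real.sqrt U) ^ 2 := by
  set C : ℝ := 100000 * U * Real.log (4 + 32 / Real.sqrt U) ^ 2 with hC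
  set u : ℕ → ℝ := fun k => (∑ x ∈ halfOpenBox 2 (2 * k), ∑ y ∈ halfOpenBox 2 (2 * k),
      torusPullback (pairFieldCorr dWaveFormFactor ψ) (2 * k) x y) /
        ((#(halfOpenBox 2 (2 * k)) : ℝ)) ^ 2 with hu
  change liminf u atTop ≤ C
  have hC0 : 0 < C := mul_mul_log_sq_four_add_pos (by norm_num) hU
  -- the `k`-th term for `k ≥ 1`, and its sign
  have hterm : ∀ k : ℕ, 1 ≤ k → ∃ n : ℕ, 2 * k = n + 1 ∧
      u k = (star (ψ (n + 1)) ⬝ᵥ (((pairField dWaveFormFactor (n + 1))ᴴ *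
        pairField dWaveFormFactor (n + 1)) *ᵥ ψ (n + 1))).re / ((n + 1 : ℕ) : ℝ) ^ 4 := by
    intro k hk
    refine ⟨2 * k - 1, by omega, ?_⟩
    have e : 2 * k = (2 * k - 1) + 1 := by omega
    simp only [hu]
    rw [e, torusLROSeq_pairFieldCorr_succ]
    rfl
  have hnonneg : ∀ k : ℕ, 1 ≤ k → 0 ≤ u k := by
    intro k hk
    obtain ⟨n, -, hn⟩ := hterm k hk
    rw [hn]
    refine div_nonneg ?_ (by positivity)
    exact (posSemidef_conjTranspose_mul_self (pairField dWaveFormFactor (n + 1))).re_dotProduct_nonneg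
      (ψ (n + 1))
  have hbdd : IsBoundedUnder (· ≥ ·) atTop u :=
    isBoundedUnder_of_eventually_ge (a := 0)
      (Filter.eventually_atTop.2 ⟨1, fun k hk => hnonneg k hk⟩)
  -- for every `c > C`, eventually `u k < c`
  have hev : ∀ c : ℝ, C < c → ∀ᶠ k in atTop, u k ≤ c := by
    intro c hc
    have hc0 : 0 < c := hC0.trans hc
    rw [Filter.eventually_atTop]
    refine ⟨⌈3200 / Real.sqrt c⌉₊ + 4, fun k hk => ?_⟩
    obtain ⟨n, hn2, hn⟩ := hterm k (by omega)
    obtain ⟨hnorm, hgs⟩ := hGS (n + 1) ⟨k, by omega⟩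
    haveI : NeZero (n + 1) := ⟨by omega⟩
    have hlt := hubbardTorus_groundState_pairDensity_lt_of_log_sq_coupling_lt (L := n + 1) hc0 hU hc
      (by omega) hgs hnorm
    rw [hn, div_le_iff₀ (by positivity)]
    exact hlt.le
  -- conclude
  by_contra hlt
  push Not at hlt
  have hmid : C < (C + liminf u atTop) / 2 := by linarith
  have h := liminf_le_of_frequently_le ((hev _ hmid).frequently) hbdd
  linarith

omit [NeZero L] in
/-- **The literal hypothesis clause of `hubbard.S01`, at any doping.** For `U > 0`, ANY real `δ`, and
`(N, ψ)` satisfying the hypothesis clause of `Literature.Hubbard.DWaveSuperconductivityHubbard` verbatim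
(at every even `L`: `N L = 2⌊(1-δ)L²/2⌋`, `ψ L` normalised, a ground state of `hubbardTorus 2 L 1 U`
in the sector `(N L, 0)`): `liminf_k |Λ_{2k}|⁻² Σ_{x,y ∈ Λ_{2k}} torusPullback (pairFieldCorr g_d ψ)
(2k) x y ≤ 10⁵·U·log²(4 + 32/√U)`. Compare `liminf_dWavePairFieldCorr_le_of_groundStates`
(`HubbardDWaveLROCeiling.lean`): `(16384/δ)·U·log(4 + 32/√U)` for `δ ∈ (0,1/2)` only.
Scalapino (1995) §2 eq. (2.4). [folklore] -/
theorem liminf_dWavePairFieldCorr_le_of_groundStates_doping {U : ℝ} (hU : 0 < U) (δ : ℝ)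
    (N : ℕ → ℕ) (ψ : ∀ L, Fock (Orb (FermionTorus 2 L)))
    (hGS : ∀ L, Even L → N L = 2 * ⌊(1 - δ) * (L : ℝ) ^ 2 / 2⌋₊ ∧ star (ψ L) ⬝ᵥ ψ L = 1 ∧
      IsGroundStateInSector (hubbardTorus 2 L 1 U) (N L) 0 (ψ L)) :
    liminf (fun k : ℕ => (∑ x ∈ halfOpenBox 2 (2 * k), ∑ y ∈ halfOpenBox 2 (2 * k),
        torusPullback (pairFieldCorr dWaveFormFactor ψ) (2 * k) x y) /
          ((#(halfOpenBox 2 (2 * k)) : ℝ)) ^ 2) atTop ≤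
      100000 * U * Real.log (4 + 32 / Real.sqrt U) ^ 2 :=
  liminf_dWavePairFieldCorr_le_of_groundStates_uniform hU N ψ fun L hL => (hGS L hL).2

end Literature.MathematicalPhysics.QuantumLattice
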